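import Mathlib.Topology.ContinuousMap.StoneWeierstrass
import Mathlib.MeasureTheory.Constructions.HaarToSphere
import Mathlib.MeasureTheory.Measure.Haar.InnerProductSpace
import Mathlib.MeasureTheory.Integral.DominatedConvergence
import Mathlib.Analysis.SpecialFunctions.Exponential
import Mathlib.Analysis.SpecificLimits.Normed
import Mathlib.Algebra.Algebra.Operations
import HarnessLib

/-!
# Rellich's lemma, III: a function on the sphere with vanishing polynomial moments vanishes

Analysis/PDE proof file (theorems only) on the discharge path of the named fact
`Literature.Analysis.PDE.Rellich1943_helmholtz_farField_uniqueness` (`RellichLemma.lean`;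
Colton–Kress 1998, Lemma 2.11). In the printed proof the vanishing of all spherical-harmonic
coefficients `a_n^m(r)` gives `u(r·) = 0` by the completeness of the spherical harmonics in
`L²(S²)` (Colton–Kress, Thm 2.7). Here the coefficients are replaced by the moments against the
powers of linear forms `⟪ξ, ·⟫ⁿ` (see `RellichSphericalMoments.lean`), and completeness by the
Stone–Weierstrass theorem:

* `integral_exp_inner_mul_eq_zero` — if `∫_S ⟪ξ,α⟫ⁿ f(α) dσ = 0` for all `n`, then
  `∫_S e^{⟪ξ,α⟫} f(α) dσ = 0` (dominated convergence for the exponential series);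
* `eq_zero_of_forall_integral_inner_pow_mul_eq_zero` — **if all the moments
  `∫_S ⟪ξ,α⟫ⁿ f(α) dσ(α)` (`ξ ∈ E`, `n ∈ ℕ`) of a continuous `f` vanish, then `f = 0` on the
  unit sphere `S`**: the linear span of the functions `e^{⟪ξ,·⟫}` is a subalgebra of `C(E, ℝ)`
  (`e^{⟪ξ,·⟫} e^{⟪η,·⟫} = e^{⟪ξ+η,·⟫}`) separating points, so by Stone–Weierstrass on the compact
  sphere (Mathlib `ContinuousMap.exists_mem_subalgebra_near_continuous_of_isCompact_of_separatesPoints`)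
  it approximates `f` uniformly on `S`; hence `∫_S f² dσ = 0`, and `f = 0` on `S` because the
  surface measure `σ = volume.toSphere` charges open sets (`Measure.toSphere.instIsOpenPosMeasure`).

## References

* D. Colton, R. Kress, *Inverse Acoustic and Electromagnetic Scattering Theory*, 2nd ed.,
  Springer 1998, Thm 2.7 (completeness of spherical harmonics) and proof of Lemma 2.11.
  [ColtonKress1998]
* M. H. Stone, *The generalized Weierstrass approximation theorem*, Math. Mag. 21 (1948).
-/

noncomputable section

open MeasureTheory MeasureTheory.Measure Set Function Filter Topology Metric
open scoped RealInnerProductSpace Nat Pointwise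

namespace Literature.Analysis.PDE

namespace Rellich

variable {E : Type*} [NormedAddCommGroup E] [InnerProductSpace ℝ E] [FiniteDimensional ℝ E]
  [MeasurableSpace E] [BorelSpace E]

/-- A continuous function on the unit sphere is integrable for the surface measure
`σ = volume.toSphere` (a finite measure on a compact space). [folklore] -/
theorem integrable_sphere_of_continuous {h : sphere (0 : E) 1 → ℝ} (hh : Continuous h) :
    Integrable h (volume : Measure E).toSphere :=
  integrableOn_univ.1 (hh.continuousOn.integrableOn_compact isCompact_univ)

omit [FiniteDimensional ℝ E] [MeasurableSpace E] [BorelSpace E] in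
/-- On the unit sphere `|⟪ξ, α⟫| ≤ ‖ξ‖`. [folklore] -/
theorem abs_inner_sphere_le (ξ : E) (α : sphere (0 : E) 1) : |⟪ξ, (α : E)⟫| ≤ ‖ξ‖ := by
  have h := abs_real_inner_le_norm ξ (α : E)
  rwa [norm_eq_of_mem_sphere α, mul_one] at h

/-- **From polynomial moments to exponential moments.** If `f` is continuous on `E` and
`∫_S ⟪ξ,α⟫ⁿ f(α) dσ = 0` for every `n`, then `∫_S e^{⟪ξ,α⟫} f(α) dσ = 0` (expand the exponential
and integrate term by term; the series is dominated by `e^{‖ξ‖} |f|`). [folklore] -/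
theorem integral_exp_inner_mul_eq_zero {f : E → ℝ} (hf : Continuous f) (ξ : E)
    (h : ∀ n : ℕ, ∫ α, ⟪ξ, (α : E)⟫ ^ n * f α ∂(volume : Measure E).toSphere = 0) :
    ∫ α, Real.exp ⟪ξ, (α : E)⟫ * f α ∂(volume : Measure E).toSphere = 0 := by
  set σ := (volume : Measure E).toSphere with hσ
  have hfc : Continuous fun α : sphere (0 : E) 1 => f α := hf.comp continuous_subtype_val
  have hic : Continuous fun α : sphere (0 : E) 1 => ⟪ξ, (α : E)⟫ :=
    continuous_const.inner continuous_subtype_val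
  -- dominated convergence for the exponential series
  have hsum := hasSum_integral_of_dominated_convergence (μ := σ)
    (F := fun (n : ℕ) (α : sphere (0 : E) 1) => ⟪ξ, (α : E)⟫ ^ n / n ! * f α)
    (f := fun α => Real.exp ⟪ξ, (α : E)⟫ * f α)
    (fun n α => ‖ξ‖ ^ n / n ! * |f α|) ?_ ?_ ?_ ?_ ?_
  · -- each term vanishes, hence so does the sum
    have hterm : ∀ n : ℕ, ∫ α, ⟪ξ, (α : E)⟫ ^ n / n ! * f α ∂σ = 0 := fun n => by
      have : (fun α : sphere (0 : E) 1 => ⟪ξ, (α : E)⟫ ^ n / n ! * f α) =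
          fun α : sphere (0 : E) 1 => (n ! : ℝ)⁻¹ * (⟪ξ, (α : E)⟫ ^ n * f α) :=
        funext fun α => by rw [div_eq_mul_inv]; ring
      rw [this, integral_const_mul, h n, mul_zero]
    simp_rw [hterm] at hsum
    exact (hsum.unique hasSum_zero)
  · intro n
    exact (((hic.pow n).div_const _).mul hfc).aestronglyMeasurable
  · intro n
    refine ae_of_all _ fun α => ?_
    rw [Real.norm_eq_abs, abs_mul, abs_div, abs_pow, Nat.abs_cast]
    gcongr
    exact abs_inner_sphere_le ξ α
  · exact ae_of_all _ fun α => (Real.summable_pow_div_factorial ‖ξ‖).mul_right _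
  · have : (fun α : sphere (0 : E) 1 => ∑' n : ℕ, ‖ξ‖ ^ n / n ! * |f α|) =
        fun α : sphere (0 : E) 1 => Real.exp ‖ξ‖ * |f α| := funext fun α => by
      rw [tsum_mul_right, Real.exp_eq_exp_ℝ, (NormedSpace.expSeries_div_hasSum_exp ‖ξ‖).tsum_eq]
    rw [this]
    exact (integrable_sphere_of_continuous hfc.abs).const_mul _
  · refine ae_of_all _ fun α => ?_
    have := (NormedSpace.expSeries_div_hasSum_exp ⟪ξ, (α : E)⟫).mul_right (f α)
    rwa [← Real.exp_eq_exp_ℝ] at this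

/-- **A continuous function with vanishing moments `∫_S ⟪ξ,α⟫ⁿ f dσ` vanishes on the sphere**
(the substitute for the completeness of the spherical harmonics, Colton–Kress Thm 2.7, in the
proof of Rellich's lemma): Stone–Weierstrass for the subalgebra of `C(E, ℝ)` spanned by the
exponentials `e^{⟪ξ,·⟫}`, restricted to the compact unit sphere, gives `∫_S f² dσ = 0`, whence
`f = 0` on `S` since `σ` charges open sets. [cite: ColtonKress1998, Thm 2.7 and Lemma 2.11 (proof)] -/
theorem eq_zero_of_forall_integral_inner_pow_mul_eq_zero {f : E → ℝ} (hf : Continuous f)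
    (h : ∀ (ξ : E) (n : ℕ), ∫ α, ⟪ξ, (α : E)⟫ ^ n * f α ∂(volume : Measure E).toSphere = 0)
    (α : sphere (0 : E) 1) : f α = 0 := by
  set σ := (volume : Measure E).toSphere with hσ
  have hfc : Continuous fun α : sphere (0 : E) 1 => f α := hf.comp continuous_subtype_val
  -- the exponentials as bundled continuous maps, and their span
  have hec : ∀ ξ : E, Continuous fun x : E => Real.exp ⟪ξ, x⟫ := fun ξ =>
    Real.continuous_exp.comp (continuous_const.inner continuous_id)
  set e : E → C(E, ℝ) := fun ξ => ⟨fun x => Real.exp ⟪ξ, x⟫, hec ξ⟩ with he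
  set W : Submodule ℝ C(E, ℝ) := Submodule.span ℝ (range e) with hW
  have h1 : (1 : C(E, ℝ)) ∈ W := by
    refine Submodule.subset_span ⟨0, ?_⟩
    ext x
    simp [he]
  have hmulset : range e * range e ⊆ range e := by
    rintro _ ⟨p, ⟨ξ, rfl⟩, q, ⟨η, rfl⟩, rfl⟩
    refine ⟨ξ + η, ?_⟩
    ext x
    simp [he, inner_add_left, Real.exp_add]
  have hmul : ∀ p q : C(E, ℝ), p ∈ W → q ∈ W → p * q ∈ W := fun p q hp hq => by
    have hpq : p * q ∈ W * W := Submodule.mul_mem_mul hp hq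
    rw [hW, Submodule.span_mul_span] at hpq
    exact Submodule.span_mono hmulset hpq
  set A : Subalgebra ℝ C(E, ℝ) := W.toSubalgebra h1 hmul with hA
  have hmemA : ∀ ξ, e ξ ∈ A := fun ξ =>
    Submodule.mem_toSubalgebra.2 (Submodule.subset_span ⟨ξ, rfl⟩)
  -- `A` separates points
  have hsep : A.SeparatesPoints := by
    intro x y hxy
    refine ⟨_, ⟨e (x - y), hmemA (x - y), rfl⟩, ?_⟩
    simp only [he, ContinuousMap.coe_mk, ne_eq]
    intro hexy
    have h' : ⟪x - y, x⟫ = ⟪x - y, y⟫ := Real.exp_injective hexy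
    have : ⟪x - y, x - y⟫ = 0 := by rw [inner_sub_right, h', sub_self]
    exact hxy (sub_eq_zero.1 (inner_self_eq_zero.1 this))
  -- every element of `A` is annihilated
  have hann : ∀ g : C(E, ℝ), g ∈ W → ∫ α, g α * f α ∂σ = 0 := by
    intro g hg
    induction hg using Submodule.span_induction with
    | mem p hp =>
        obtain ⟨ξ, rfl⟩ := hp
        simpa [he] using integral_exp_inner_mul_eq_zero hf ξ (h ξ)
    | zero => simp
    | add p q _ _ hp hq =>
        have hip : Integrable (fun α : sphere (0 : E) 1 => p α * f α) σ :=
          integrable_sphere_of_continuous ((p.continuous.comp continuous_subtype_val).mul hfc)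
        have hiq : Integrable (fun α : sphere (0 : E) 1 => q α * f α) σ :=
          integrable_sphere_of_continuous ((q.continuous.comp continuous_subtype_val).mul hfc)
        simp only [ContinuousMap.add_apply, add_mul]
        rw [integral_add hip hiq, hp, hq, add_zero]
    | smul c p _ hp =>
        simp only [ContinuousMap.smul_apply, smul_eq_mul, mul_assoc]
        rw [integral_const_mul, hp, mul_zero]
  -- Stone–Weierstrass on the compact unit sphere: `∫ f² dσ ≤ ε ∫ |f| dσ` for all `ε > 0`
  set F : C(E, ℝ) := ⟨f, hf⟩ with hF
  have hif : Integrable (fun α : sphere (0 : E) 1 => |f α|) σ :=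
    integrable_sphere_of_continuous hfc.abs
  have hiff : Integrable (fun α : sphere (0 : E) 1 => f α * f α) σ :=
    integrable_sphere_of_continuous (hfc.mul hfc)
  have hle : ∀ ε, 0 < ε → ∫ α, f α * f α ∂σ ≤ ε * ∫ α, |f α| ∂σ := by
    intro ε hε
    obtain ⟨g, hgA, hg⟩ :=
      ContinuousMap.exists_mem_subalgebra_near_continuous_of_isCompact_of_separatesPoints hsep F
        (isCompact_sphere (0 : E) 1) hε
    have hig : Integrable (fun α : sphere (0 : E) 1 => g α * f α) σ :=
      integrable_sphere_of_continuous ((g.continuous.comp continuous_subtype_val).mul hfc)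
    have hifg : Integrable (fun α : sphere (0 : E) 1 => (f α - g α) * f α) σ :=
      integrable_sphere_of_continuous
        ((hfc.sub (g.continuous.comp continuous_subtype_val)).mul hfc)
    have hsplit : ∫ α, f α * f α ∂σ =
        (∫ α, (f α - g α) * f α ∂σ) + ∫ α, g α * f α ∂σ := by
      rw [← integral_add hifg hig]
      exact integral_congr_ae (ae_of_all _ fun α => by ring)
    rw [hsplit, hann g (Submodule.mem_toSubalgebra.1 hgA), add_zero, ← integral_const_mul]
    refine integral_mono hifg (hif.const_mul ε) fun α => ?_
    have hgx := hg (α : E) α.2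
    simp only [hF, ContinuousMap.coe_mk, Real.norm_eq_abs] at hgx
    calc (f α - g α) * f α ≤ |(f α - g α) * f α| := le_abs_self _
      _ = |g α - f α| * |f α| := by rw [abs_mul, abs_sub_comm]
      _ ≤ ε * |f α| := mul_le_mul_of_nonneg_right hgx.le (abs_nonneg _)
  -- hence `∫ f² dσ = 0`
  have hC : 0 ≤ ∫ α, |f α| ∂σ := integral_nonneg fun α => abs_nonneg _
  have hI0 : ∫ α, f α * f α ∂σ ≤ 0 := by
    refine le_of_forall_pos_le_add fun δ hδ => ?_
    have hε : 0 < δ / (∫ α, |f α| ∂σ + 1) := div_pos hδ (by linarith)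
    calc ∫ α, f α * f α ∂σ ≤ δ / (∫ α, |f α| ∂σ + 1) * ∫ α, |f α| ∂σ := hle _ hε
      _ ≤ δ / (∫ α, |f α| ∂σ + 1) * (∫ α, |f α| ∂σ + 1) :=
          mul_le_mul_of_nonneg_left (by linarith) hε.le
      _ = δ := div_mul_cancel₀ δ (by linarith)
      _ ≤ 0 + δ := by rw [zero_add]
  have hInn : 0 ≤ ∫ α, f α * f α ∂σ := integral_nonneg fun α => mul_self_nonneg _
  have hI : ∫ α, f α * f α ∂σ = 0 := le_antisymm hI0 hInn
  -- and `f = 0` on the sphere, as `σ` charges open sets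
  have hae : (fun α : sphere (0 : E) 1 => f α * f α) =ᵐ[σ] 0 :=
    (integral_eq_zero_iff_of_nonneg (fun α => mul_self_nonneg _) hiff).1 hI
  have heq : (fun α : sphere (0 : E) 1 => f α * f α) = fun _ => 0 :=
    (Continuous.ae_eq_iff_eq σ (hfc.mul hfc) continuous_const).1 hae
  have := congrFun heq α
  simpa using this

end Rellich

end Literature.Analysis.PDE

end
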